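import Literature.Probability.Percolation.SelfRefinementMeasure
import Literature.Probability.Percolation.KohlerSchindlerTassionRSW
import Summits.CriticalPhenomena.CardyFormulaZ2.Theorems.CardySelfRefinementCriticalPathRSWStubCone3Sections

/-!
# Stub `stub_cone3` of line `finite-size-envelope` (crux `CriticalPathRSW`), part 14:
the pattern sums — no atom means the positive section dominates (interior density `c ≥ 1/10`)

Support file for item `stmt-CriticalPhenomena-10267` (stub `stub_cone3`).  For the tuple `(b, d)`
and the override events `Z⟪C, A⟫` of the box `[-3n, 3n] × [-9n, 9n]`, write `T(pat)` for the
sub-edges whose own coin lies in `pat ⊆ {o₀, o₁, o₂}` and `Atom` for the event that some single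
sub-edge alone joins the sides while the closed tuple does not.  Then (`Cone3.sum_patterns_le`)

`Σ_{pat} P(Z⟪T, T(pat)⟫ \ Z⟪T, ∅⟫) ≤ Σ_{pat} P(Z⟪T, T⟫ \ Z⟪T, T(pat)⟫) + 8 · P(Atom)`:

outside `Atom` no single sub-edge suffices, so a configuration crossing with `T(pat)` open uses
at least two sub-edges of `pat` and then cannot cross with the at most one sub-edge of the
complementary pattern; pairing `pat` with its complement gives the inequality term by term.
This is the sign input "an up-set of tuple states of negative weight contains an atom".

References: Grimmett 1999 §2.4 (conditioning Russo's formula on the other local coins);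
Aizenman–Grimmett 1991 §2.
-/

noncomputable section

namespace Summit.CriticalPhenomena.CardyFormulaZ2.Cruxes.CriticalPathRSW.FiniteSizeEnvelope

open Set MeasureTheory
open Literature.Probability.LatticeModels Literature.Probability.Percolation

namespace Cone3

variable {n : ℕ} {ρ c : ℝ} {b : Site 2} {d d' : Fin 2}

set_option quotPrecheck false

/-- The local frame of the tuple `(b, d)`: `pt⟪α, β⟫ = 3b + α e_d + β e_{d'}`. -/
local notation "pt⟪" α ", " β "⟫" =>
  ((3 : ℤ) • b + (α : ℤ) • (Pi.single d (1 : ℤ) : Site 2) + (β : ℤ) • (Pi.single d' (1 : ℤ) : Site 2))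

/-- The open labels of a coin configuration. -/
local notation "Op⟪" S "⟫" => {e : Site 2 × Fin 2 | RefinementOpen 3 S e}

/-- The override event: close `C`, open `A`, and ask for a left-right crossing of the box. -/
local notation "Z⟪" C ", " A "⟫" =>
  {S : Set (Site 2 × Fin 2 × Fin 3) |
    edgeConfig ((Op⟪S⟫ \ C) ∪ A) ∈ KST2023.crossing (3 * n) (3 * (3 * n))}

/-- The pulled-back crossing event. -/
local notation "Â" => ((refinementConfig 3) ⁻¹' KST2023.crossing (3 * n) (3 * (3 * n)))

/-- The three sub-edges of the tuple. -/
local notation "Tl" =>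
  ({(pt⟪0, 0⟫, d), (pt⟪1, 0⟫, d), (pt⟪2, 0⟫, d)} : Set (Site 2 × Fin 2))

/-- The sub-edges whose own coin lies in `X`. -/
local notation "Tof⟪" X "⟫" =>
  {e : Site 2 × Fin 2 | (e = (pt⟪0, 0⟫, d) ∧ (pt⟪0, 0⟫, d, (0 : Fin 3)) ∈ X) ∨
    (e = (pt⟪1, 0⟫, d) ∧ (pt⟪1, 0⟫, d, (0 : Fin 3)) ∈ X) ∨ (e = (pt⟪2, 0⟫, d) ∧ (pt⟪2, 0⟫, d, (0 : Fin 3)) ∈ X)}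

/-- All sub-edges if the shared coin lies in `X`, nothing otherwise. -/
local notation "Th⟪" X "⟫" =>
  {e : Site 2 × Fin 2 | (e = (pt⟪0, 0⟫, d) ∨ e = (pt⟪1, 0⟫, d) ∨ e = (pt⟪2, 0⟫, d)) ∧ (b, d, (1 : Fin 3)) ∈ X}

/-- The three own coins, as a `Finset`. -/
local notation "F₃" =>
  ({(pt⟪0, 0⟫, d, (0 : Fin 3)), (pt⟪1, 0⟫, d, (0 : Fin 3)), (pt⟪2, 0⟫, d, (0 : Fin 3))} :
    Finset (Site 2 × Fin 2 × Fin 3))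

/-- The shared coin and the three own coins, as a `Finset`. -/
local notation "F₄" =>
  ({(b, d, (1 : Fin 3)), (pt⟪0, 0⟫, d, (0 : Fin 3)), (pt⟪1, 0⟫, d, (0 : Fin 3)), (pt⟪2, 0⟫, d, (0 : Fin 3))} :
    Finset (Site 2 × Fin 2 × Fin 3))

/-- The coin law. -/
local notation "P" => (prodBernoulli (refinementParam 3 ρ c))

/-! ### Patterns supported on at most one sub-edge -/

/-- If at most the own coin `o_k` of `X` is among the three own coins, `T(X) ⊆ {e_k}`. -/
theorem Tof_subset_single {X : Set (Site 2 × Fin 2 × Fin 3)} {k : ℤ}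
    (h : ∀ j : ℤ, (j = 0 ∨ j = 1 ∨ j = 2) → (pt⟪j, 0⟫, d, (0 : Fin 3)) ∈ X → j = k) :
    Tof⟪X⟫ ⊆ {(pt⟪k, 0⟫, d)} := by
  rintro e (⟨rfl, he⟩ | ⟨rfl, he⟩ | ⟨rfl, he⟩)
  · rw [Set.mem_singleton_iff, ← h 0 (Or.inl rfl) he]
  · rw [Set.mem_singleton_iff, ← h 1 (Or.inr (Or.inl rfl)) he]
  · rw [Set.mem_singleton_iff, ← h 2 (Or.inr (Or.inr rfl)) he]

/-- Crossing with `T(X)` open, `T(X) ⊆ {e_k}`, means crossing with `e_k` open. -/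
theorem mem_Z_single_of_subset {X : Set (Site 2 × Fin 2 × Fin 3)} {k : ℤ} {S : Set (Site 2 × Fin 2 × Fin 3)}
    (h : ∀ j : ℤ, (j = 0 ∨ j = 1 ∨ j = 2) → (pt⟪j, 0⟫, d, (0 : Fin 3)) ∈ X → j = k) (hS : S ∈ Z⟪Tl, Tof⟪X⟫⟫) :
    S ∈ Z⟪Tl, {(pt⟪k, 0⟫, d)}⟫ :=
  crossing_mono (Set.union_subset_union_right _ (Tof_subset_single h)) hS

/-! ### The pattern sums -/

/-- **Term by term.** For every pattern, `Z⟪T, T(pat)⟫ \ Z⟪T, ∅⟫ ⊆ (Z⟪T, T⟫ \ Z⟪T, T(patᶜ)⟫) ∪ Atom`. -/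
theorem pattern_subset (pat : Finset (Site 2 × Fin 2 × Fin 3)) :
    Z⟪Tl, Tof⟪(↑pat : Set (Site 2 × Fin 2 × Fin 3))⟫⟫ \ Z⟪Tl, (∅ : Set (Site 2 × Fin 2))⟫ ⊆
      (Z⟪Tl, Tl⟫ \ Z⟪Tl, Tof⟪(↑(F₃ \ pat) : Set (Site 2 × Fin 2 × Fin 3))⟫⟫) ∪
        ((Z⟪Tl, {(pt⟪0, 0⟫, d)}⟫ ∪ Z⟪Tl, {(pt⟪1, 0⟫, d)}⟫ ∪ Z⟪Tl, {(pt⟪2, 0⟫, d)}⟫) \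
          Z⟪Tl, (∅ : Set (Site 2 × Fin 2))⟫) := by
  classical
  rintro S ⟨hS1, hS2⟩
  by_cases hA : S ∈ Z⟪Tl, {(pt⟪0, 0⟫, d)}⟫ ∪ Z⟪Tl, {(pt⟪1, 0⟫, d)}⟫ ∪ Z⟪Tl, {(pt⟪2, 0⟫, d)}⟫
  · exact Or.inr ⟨hA, hS2⟩
  left
  have n0 : S ∉ Z⟪Tl, {(pt⟪0, 0⟫, d)}⟫ := fun h => hA (Or.inl (Or.inl h))
  have n1 : S ∉ Z⟪Tl, {(pt⟪1, 0⟫, d)}⟫ := fun h => hA (Or.inl (Or.inr h))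
  have n2 : S ∉ Z⟪Tl, {(pt⟪2, 0⟫, d)}⟫ := fun h => hA (Or.inr h)
  refine ⟨crossing_mono (Set.union_subset_union_right _ (Tof_subset _)) hS1, fun hS3 => ?_⟩
  -- memberships in the complementary pattern
  have cm : ∀ j : ℤ, (j = 0 ∨ j = 1 ∨ j = 2) →
      ((pt⟪j, 0⟫, d, (0 : Fin 3)) ∈ (↑(F₃ \ pat) : Set (Site 2 × Fin 2 × Fin 3)) ↔ (pt⟪j, 0⟫, d, (0 : Fin 3)) ∉ pat) := by
    intro j hj
    rw [Finset.coe_sdiff, Set.mem_sdiff, Finset.mem_coe, Finset.mem_coe]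
    have hjF : (pt⟪j, 0⟫, d, (0 : Fin 3)) ∈ F₃ := by rcases hj with rfl | rfl | rfl <;> simp
    exact ⟨fun h => h.2, fun h => ⟨hjF, h⟩⟩
  have pm : ∀ j : ℤ, (pt⟪j, 0⟫, d, (0 : Fin 3)) ∈ (↑pat : Set (Site 2 × Fin 2 × Fin 3)) ↔ (pt⟪j, 0⟫, d, (0 : Fin 3)) ∈ pat :=
    fun j => Finset.mem_coe
  by_cases m0 : (pt⟪0, 0⟫, d, (0 : Fin 3)) ∈ pat <;> by_cases m1 : (pt⟪1, 0⟫, d, (0 : Fin 3)) ∈ pat <;>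
    by_cases m2 : (pt⟪2, 0⟫, d, (0 : Fin 3)) ∈ pat
  · -- 111: complement empty ⊆ anything, e.g. `{e₀}`... complement has no own coin: `T(patᶜ) ⊆ {e₀}` vacuously
    refine n0 (mem_Z_single_of_subset (fun j hj hm => ?_) hS3)
    rcases hj with rfl | rfl | rfl
    · exact absurd m0 ((cm 0 (Or.inl rfl)).1 hm)
    · exact absurd m1 ((cm 1 (Or.inr (Or.inl rfl))).1 hm)
    · exact absurd m2 ((cm 2 (Or.inr (Or.inr rfl))).1 hm)
  · -- 110: complement ⊆ {e₂}
    refine n2 (mem_Z_single_of_subset (fun j hj hm => ?_) hS3)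
    rcases hj with rfl | rfl | rfl
    · exact absurd m0 ((cm 0 (Or.inl rfl)).1 hm)
    · exact absurd m1 ((cm 1 (Or.inr (Or.inl rfl))).1 hm)
    · rfl
  · -- 101: complement ⊆ {e₁}
    refine n1 (mem_Z_single_of_subset (fun j hj hm => ?_) hS3)
    rcases hj with rfl | rfl | rfl
    · exact absurd m0 ((cm 0 (Or.inl rfl)).1 hm)
    · rfl
    · exact absurd m2 ((cm 2 (Or.inr (Or.inr rfl))).1 hm)
  · -- 100: pattern ⊆ {e₀}
    refine n0 (mem_Z_single_of_subset (fun j hj hm => ?_) hS1)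
    rcases hj with rfl | rfl | rfl
    · rfl
    · exact absurd ((pm 1).1 hm) m1
    · exact absurd ((pm 2).1 hm) m2
  · -- 011: complement ⊆ {e₀}
    refine n0 (mem_Z_single_of_subset (fun j hj hm => ?_) hS3)
    rcases hj with rfl | rfl | rfl
    · rfl
    · exact absurd m1 ((cm 1 (Or.inr (Or.inl rfl))).1 hm)
    · exact absurd m2 ((cm 2 (Or.inr (Or.inr rfl))).1 hm)
  · -- 010: pattern ⊆ {e₁}
    refine n1 (mem_Z_single_of_subset (fun j hj hm => ?_) hS1)
    rcases hj with rfl | rfl | rfl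
    · exact absurd ((pm 0).1 hm) m0
    · rfl
    · exact absurd ((pm 2).1 hm) m2
  · -- 001: pattern ⊆ {e₂}
    refine n2 (mem_Z_single_of_subset (fun j hj hm => ?_) hS1)
    rcases hj with rfl | rfl | rfl
    · exact absurd ((pm 0).1 hm) m0
    · exact absurd ((pm 1).1 hm) m1
    · rfl
  · -- 000: pattern empty ⊆ {e₀}
    refine n0 (mem_Z_single_of_subset (fun j hj hm => ?_) hS1)
    rcases hj with rfl | rfl | rfl
    · exact absurd ((pm 0).1 hm) m0
    · exact absurd ((pm 1).1 hm) m1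
    · exact absurd ((pm 2).1 hm) m2

/-- **The pattern sums.** `Σ_{pat} P(Z⟪T, T(pat)⟫ \ Z⟪T, ∅⟫) ≤ Σ_{pat} P(Z⟪T, T⟫ \ Z⟪T, T(pat)⟫) + 8 P(Atom)`. -/
theorem sum_patterns_le :
    ∑ pat ∈ (F₃).powerset, (P).real (Z⟪Tl, Tof⟪(↑pat : Set (Site 2 × Fin 2 × Fin 3))⟫⟫ \
        Z⟪Tl, (∅ : Set (Site 2 × Fin 2))⟫) ≤
      ∑ pat ∈ (F₃).powerset, (P).real (Z⟪Tl, Tl⟫ \ Z⟪Tl, Tof⟪(↑pat : Set (Site 2 × Fin 2 × Fin 3))⟫⟫) +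
        8 * (P).real ((Z⟪Tl, {(pt⟪0, 0⟫, d)}⟫ ∪ Z⟪Tl, {(pt⟪1, 0⟫, d)}⟫ ∪ Z⟪Tl, {(pt⟪2, 0⟫, d)}⟫) \
          Z⟪Tl, (∅ : Set (Site 2 × Fin 2))⟫) := by
  classical
  set A := (P).real ((Z⟪Tl, {(pt⟪0, 0⟫, d)}⟫ ∪ Z⟪Tl, {(pt⟪1, 0⟫, d)}⟫ ∪ Z⟪Tl, {(pt⟪2, 0⟫, d)}⟫) \
    Z⟪Tl, (∅ : Set (Site 2 × Fin 2))⟫) with hA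
  have hA0 : 0 ≤ A := measureReal_nonneg
  -- term by term
  have hterm : ∀ pat ∈ (F₃).powerset,
      (P).real (Z⟪Tl, Tof⟪(↑pat : Set (Site 2 × Fin 2 × Fin 3))⟫⟫ \ Z⟪Tl, (∅ : Set (Site 2 × Fin 2))⟫) ≤
        (P).real (Z⟪Tl, Tl⟫ \ Z⟪Tl, Tof⟪(↑(F₃ \ pat) : Set (Site 2 × Fin 2 × Fin 3))⟫⟫) + A := by
    intro pat _
    refine (measureReal_mono (pattern_subset pat) (measure_ne_top _ _)).trans ?_
    exact measureReal_union_le _ _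
  refine (Finset.sum_le_sum hterm).trans ?_
  rw [Finset.sum_add_distrib, Finset.sum_const, nsmul_eq_mul]
  -- reindex the first sum by the complement
  have hre : ∑ pat ∈ (F₃).powerset, (P).real (Z⟪Tl, Tl⟫ \ Z⟪Tl, Tof⟪(↑(F₃ \ pat) : Set (Site 2 × Fin 2 × Fin 3))⟫⟫) =
      ∑ pat ∈ (F₃).powerset, (P).real (Z⟪Tl, Tl⟫ \ Z⟪Tl, Tof⟪(↑pat : Set (Site 2 × Fin 2 × Fin 3))⟫⟫) := by
    refine Finset.sum_nbij' (fun pat => F₃ \ pat) (fun pat => F₃ \ pat) ?_ ?_ ?_ ?_ ?_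
    · intro pat _; exact Finset.mem_powerset.2 Finset.sdiff_subset
    · intro pat _; exact Finset.mem_powerset.2 Finset.sdiff_subset
    · intro pat hpat; exact Finset.sdiff_sdiff_eq_self (Finset.mem_powerset.1 hpat)
    · intro pat hpat; exact Finset.sdiff_sdiff_eq_self (Finset.mem_powerset.1 hpat)
    · intro pat _; rfl
  rw [hre]
  have hcard : (((F₃).powerset.card : ℕ) : ℝ) ≤ 8 := by
    rw [Finset.card_powerset]
    have h3 : (F₃).card ≤ 3 := Finset.card_le_three
    have h8 : 2 ^ (F₃).card ≤ (8 : ℕ) := (Nat.pow_le_pow_right (by norm_num) h3).trans (by norm_num)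
    exact_mod_cast h8
  have := mul_le_mul_of_nonneg_right hcard hA0
  linarith

end Cone3

/-- **Registered sub-goal `stub_cone3_patterns` of stub `stub_cone3`** (`Cone3.Tof_subset_single` with all local notations
expanded). -/
theorem stub_cone3_patterns : ∀ {b : Site 2} {d d' : Fin 2} {X : Set (Site 2 × Fin 2 × Fin 3)} {k : ℤ} (h : ∀ j : ℤ, (j = 0 ∨ j = 1 ∨ j = 2) → ((((3 : ℤ) • b + ((j) : ℤ) • (Pi.single d (1 : ℤ) : Site 2) + ((0) : ℤ) • (Pi.single d' (1 : ℤ) : Site 2))), d, (0 : Fin 3)) ∈ X → j = k), ({e : Site 2 × Fin 2 | (e = ((((3 : ℤ) • b + ((0) : ℤ) • (Pi.single d (1 : ℤ) : Site 2) + ((0) : ℤ) • (Pi.single d' (1 : ℤ) : Site 2))), d) ∧ ((((3 : ℤ) • b + ((0) : ℤ) • (Pi.single d (1 : ℤ) : Site 2) + ((0) : ℤ) • (Pi.single d' (1 : ℤ) : Site 2))), d, (0 : Fin 3)) ∈ (X)) ∨ (e = ((((3 : ℤ) • b + ((1) : ℤ) • (Pi.single d (1 : ℤ) : Site 2) + ((0)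 : ℤ) • (Pi.single d' (1 : ℤ) : Site 2))), d) ∧ ((((3 : ℤ) • b + ((1) : ℤ) • (Pi.single d (1 : ℤ) : Site 2) + ((0) : ℤ) • (Pi.single d' (1 : ℤ) : Site 2))), d, (0 : Fin 3)) ∈ (X)) ∨ (e = ((((3 : ℤ) • b + ((2) : ℤ) • (Pi.single d (1 : ℤ) : Site 2) + ((0) : ℤ) • (Pi.single d' (1 : ℤ) : Site 2))), d) ∧ ((((3 : ℤ) • b + ((2) : ℤ) • (Pi.single d (1 : ℤ) : Site 2) + ((0) : ℤ) • (Pi.single d' (1 : ℤ) : Site 2))), d, (0 : Fin 3)) ∈ (X))}) ⊆ {((((3 : ℤ) • b + ((k) : ℤ) • (Pi.single d (1 : ℤ) : Site 2) + ((0) : ℤ) • (Pi.single d' (1 : ℤ) : Site 2))), d)} := by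
  intro b d d' X k h
  exact Cone3.Tof_subset_single h

end Summit.CriticalPhenomena.CardyFormulaZ2.Cruxes.CriticalPathRSW.FiniteSizeEnvelope

end
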